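/-
Copyright (c) 2026 the pub-hodgecm-mathlib formalisation cell (harness21).  Prover seat hodgecm-mathlib-F0P3a-p04 (g31), 2026-09-03.  E1 row 47d «ASSEMBLY» — glue G1∕G2
(E1 keeper F0P3a-p03 (g29) 02:28:58Z; interim reader F0P3a-p09 (g15) 02:46:28Z «G1–G4 type now»; census row 47 `CENSUS-NONELL-VANISHING.v1` (F0P3-p02 (g26)) §2 (A2)–(A3)).
-/
import Mathlib.RepresentationTheory.Coinvariants
import Mathlib.RepresentationTheory.Intertwining
import Mathlib.LinearAlgebra.Isomorphisms
import HarnessLib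

/-!
# Two dictionaries for intertwiners: SEMIDIRECT FROBENIUS `Hom_{C·N}(E, W) ≃ Hom_C(E_N, W|_C)` (W trivial on N) and TRANSPORT of local intertwiners along a conjugation
# (Bernstein–Zelevinsky 1977 §1.8, §2.3; Casselman 1995 §3.1; Bump 1997 Exercise 4.5.5)

Topic `NumberTheory/Automorphic`; declarations in Mathlib's `Representation` namespace.  THEOREMS ONLY (no definition, no instance, no notation, no named fact, no `sorry`); pure algebra
(no topology).  Everything is HYPOTHESIS-STYLE: the coinvariant quotient is any surjection `q : E ↠ Q` with kernel the `N`-coinvariant kernel and a compatible `C`-action `σ_Q`; the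
transport is along abstract group homomorphisms `i : S →* Γ`, `i′ : S′ →* Γ` and an isomorphism `φ : S ≃* S′` with `i′ (φ s) = g · i s · g⁻¹`.  Cell `pub/hodgecm-mathlib` (D-0151),
crux H413 = `stmt-HodgeConjecture-24833`, lane `--supports`; E1 BRICK LEDGER row 47d (census row 47 §5 R47-d ASSEMBLY «`tr (i_B χ)(f_EP^{V,e}) = 0`»), glue (G1)(G2): they carry the
local Mackey terms of ★ 47b (`Hom_{P_F ∩ g⁻¹Bg}(V^{U_F}|, (χδ^{1∕2})^g)`) to the apartment facet `gF` (G1) and then to the `T_c`-module of `N ∩ P_{gF}`-coinvariants of `V^{U_{gF}}` (G2,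
`B ∩ P_{gF} = T_c · (N ∩ P_{gF})`), where ★ 47c∕4χ count `χ′`-eigenspaces.  HONEST LABEL: count-neutral generic base layer; (R-SS) NOT chartered; E1 = PRINT until the keeper's charter
test; HC_CM is proved only modulo the 2 remaining named inputs (hLiu418 = `stmt-HodgeConjecture-24832`, h413 = `stmt-HodgeConjecture-24833`) until rung 0 closes.

THE MATHEMATICS.  (G2) `S` a group generated by subgroups `C`, `N` as `S = C·N` (`hdec`), `E` an `S`-representation, `W` an `S`-representation TRIVIAL ON `N`, `q : E ↠ Q` with
`ker q = span{ρ n e − e : n ∈ N}` and `C` acting on `Q` through `q`.  An `S`-map `E → W` kills `ker q` (it is `N`-invariant into `W^N = W`) so factors through `Q`, `C`-equivariantly;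
conversely `ψ ∘ q` is `S`-equivariant because `s = c n`, `q(ρ n e) = q e` and `σ_W(c n) = σ_W c`.  So `Hom_S(E, W) ≃ₗ Hom_C(Q, W|_C)` [BZ77 §1.8 with `P = C ⋉ N`, the `θ = 1` Jacquet
adjunction; Casselman §3.1].  (G1) `ρ` a `Γ`-representation, `g ∈ Γ`, `E, E′ ≤ V` with `ρ(g) E = E′`, groups `S →ⁱ Γ`, `S′ →^{i′} Γ` acting on `E`, `E′` through `ρ` and an isomorphism
`φ : S ≃ S′` with `i′(φ s) = g i(s) g⁻¹`, targets `σ = σ′ ∘ φ`: then `f ↦ f ∘ ρ(g⁻¹)` is `Hom_S(E, σ) ≃ₗ Hom_{S′}(E′, σ′)` [Bump Ex. 4.5.5; BZ77 §2.3].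

* §1 (G2) `apply_sub_mem_ker_of_trivial`, **`nonempty_intertwiningMap_linearEquiv_of_semidirect`**, `finrank_intertwiningMap_eq_of_semidirect`.
* §2 (G1) **`nonempty_intertwiningMap_linearEquiv_of_transport`**, `finrank_intertwiningMap_eq_of_transport`.

## References
* [BernsteinZelevinsky1977] I. N. Bernstein, A. V. Zelevinsky, *Induced representations of reductive 𝔭-adic groups I*, Ann. Sci. ÉNS 10 (1977): §1.8 (`Hom_P(π, σ) = Hom_M(π_N, σ)`), §2.3.
* [Casselman1995] W. Casselman, *Introduction to the theory of admissible representations of p-adic reductive groups*: §3.1 (Jacquet module adjunction).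
* [Bump1997] D. Bump, *Automorphic Forms and Representations* (1997): Exercise 4.5.5 (simple Mackey theory: transport of local intertwiners).
-/

set_option autoImplicit false

namespace Representation

/-! ## §1 (G2) Semidirect Frobenius: `Hom_{C·N}(E, W) ≃ₗ Hom_C(Q, W|_C)` for `W` trivial on `N` and `q : E ↠ Q = E_N` -/

section Semidirect

variable {k S E Q W : Type*} [Field k] [Group S] [AddCommGroup E] [Module k E] [AddCommGroup Q] [Module k Q] [AddCommGroup W] [Module k W]
  (ρE : Representation k S E) (σW : Representation k S W) (C N : Subgroup S)

/-- An `S`-map into a representation trivial on `N` kills the `N`-coinvariant kernel of the source. [cite: BernsteinZelevinsky1977, §1.8] -/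
theorem intertwiningMap_apply_eq_zero_of_mem_coinvariantsKer (hWN : ∀ n ∈ N, σW n = 1) (f : IntertwiningMap ρE σW) {x : E} (hx : x ∈ Coinvariants.ker (ρE.comp N.subtype)) :
    f x = 0 := by
  refine Submodule.span_induction (p := fun x _ => f x = 0) ?_ (map_zero f) (fun x y _ _ hx hy => by rw [map_add, hx, hy, add_zero])
    (fun a x _ hx => by rw [map_smul, hx, smul_zero]) hx
  rintro _ ⟨⟨n, e⟩, rfl⟩
  change f (ρE (n : S) e - e) = 0
  rw [map_sub, IntertwiningMap.isIntertwining ρE σW f, hWN n n.2, Module.End.one_apply, sub_self]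

/-- **(G2) SEMIDIRECT FROBENIUS `Hom_{S}(E, W) ≃ₗ Hom_C(Q, W|_C)`** for `S = C·N` (`hdec`), `W` trivial on `N` (`hWN`), `q : E ↠ Q` with `ker q` the `N`-coinvariant kernel (`hker`) and `C` acting
on `Q` through `q` (`hσQ`); the equivalence is `f ↦ ψ` with `ψ (q e) = f e`. [cite: BernsteinZelevinsky1977, §1.8] [cite: Casselman1995, §3.1] -/
theorem nonempty_intertwiningMap_linearEquiv_of_semidirect (hdec : ∀ s : S, ∃ c ∈ C, ∃ n ∈ N, s = c * n) (hWN : ∀ n ∈ N, σW n = 1)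
    (q : E →ₗ[k] Q) (hq : Function.Surjective q) (hker : LinearMap.ker q = Coinvariants.ker (ρE.comp N.subtype))
    (σQ : Representation k C Q) (hσQ : ∀ (c : C) (e : E), q (ρE (c : S) e) = σQ c (q e)) :
    ∃ eqv : IntertwiningMap ρE σW ≃ₗ[k] IntertwiningMap σQ (σW.comp C.subtype), ∀ (f : IntertwiningMap ρE σW) (e : E), eqv f (q e) = f e := by
  classical
  -- factoring a map that kills `ker q` through the surjection `q`
  let lift : IntertwiningMap ρE σW → (Q →ₗ[k] W) := fun f =>
    ((LinearMap.ker q).liftQ f.toLinearMap (fun x hx => by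
      rw [LinearMap.mem_ker]
      exact intertwiningMap_apply_eq_zero_of_mem_coinvariantsKer ρE σW N hWN f (hker ▸ hx))) ∘ₗ (q.quotKerEquivOfSurjective hq).symm.toLinearMap
  have hlift : ∀ (f : IntertwiningMap ρE σW) (e : E), lift f (q e) = f e := fun f e => by
    simp only [lift, LinearMap.comp_apply, LinearEquiv.coe_toLinearMap, LinearMap.quotKerEquivOfSurjective_symm_apply, Submodule.liftQ_apply]
    rfl
  have hN : ∀ (n : S), n ∈ N → ∀ e : E, q (ρE n e) = q e := fun n hn e => by
    rw [← sub_eq_zero, ← map_sub, ← LinearMap.mem_ker, hker]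
    exact Coinvariants.mem_ker_of_eq (ρ := ρE.comp N.subtype) ⟨n, hn⟩ e _ rfl
  refine ⟨{ toFun := fun f => LinearMap.intertwiningMap_of_isIntertwiningMap σQ (σW.comp C.subtype) (lift f) (fun c x => ?_)
            map_add' := fun f f' => IntertwiningMap.ext (LinearMap.ext fun x => ?_)
            map_smul' := fun a f => IntertwiningMap.ext (LinearMap.ext fun x => ?_)
            invFun := fun ψ => LinearMap.intertwiningMap_of_isIntertwiningMap ρE σW (ψ.toLinearMap ∘ₗ q) (fun s e => ?_)
            left_inv := fun f => IntertwiningMap.ext (LinearMap.ext fun e => ?_)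
            right_inv := fun ψ => IntertwiningMap.ext (LinearMap.ext fun x => ?_) }, fun f e => hlift f e⟩
  · -- `C`-equivariance of the lift
    obtain ⟨e, rfl⟩ := hq x
    rw [← hσQ, hlift, hlift, IntertwiningMap.isIntertwining ρE σW f]
    rfl
  · obtain ⟨e, rfl⟩ := hq x
    change lift (f + f') (q e) = lift f (q e) + lift f' (q e)
    rw [hlift, hlift, hlift]
    rfl
  · obtain ⟨e, rfl⟩ := hq x
    change lift (a • f) (q e) = a • lift f (q e)
    rw [hlift, hlift]
    rfl
  · -- `S`-equivariance of `ψ ∘ q`: `s = c n`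
    obtain ⟨c, hc, n, hn, rfl⟩ := hdec s
    have h1 : q (ρE (c * n) e) = σQ ⟨c, hc⟩ (q e) := by
      rw [map_mul, Module.End.mul_apply]
      exact (hσQ ⟨c, hc⟩ (ρE n e)).trans (by rw [hN n hn])
    have h2 : σW (c * n) = σW c := by rw [map_mul, hWN n hn, mul_one]
    rw [LinearMap.comp_apply, LinearMap.comp_apply, h1, h2, IntertwiningMap.toLinearMap_apply, IntertwiningMap.toLinearMap_apply,
      IntertwiningMap.isIntertwining σQ (σW.comp C.subtype) ψ]
    rfl
  · change lift f (q e) = f e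
    exact hlift f e
  · obtain ⟨e, rfl⟩ := hq x
    change lift _ (q e) = ψ (q e)
    rw [hlift]
    rfl

/-- **`dim Hom_{S}(E, W) = dim Hom_C(Q, W|_C)`** under (G2)'s hypotheses. [cite: BernsteinZelevinsky1977, §1.8] [cite: Casselman1995, §3.1] -/
theorem finrank_intertwiningMap_eq_of_semidirect (hdec : ∀ s : S, ∃ c ∈ C, ∃ n ∈ N, s = c * n) (hWN : ∀ n ∈ N, σW n = 1)
    (q : E →ₗ[k] Q) (hq : Function.Surjective q) (hker : LinearMap.ker q = Coinvariants.ker (ρE.comp N.subtype))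
    (σQ : Representation k C Q) (hσQ : ∀ (c : C) (e : E), q (ρE (c : S) e) = σQ c (q e)) :
    Module.finrank k (IntertwiningMap ρE σW) = Module.finrank k (IntertwiningMap σQ (σW.comp C.subtype)) := by
  obtain ⟨eqv, -⟩ := nonempty_intertwiningMap_linearEquiv_of_semidirect ρE σW C N hdec hWN q hq hker σQ hσQ
  exact eqv.finrank_eq

end Semidirect

/-! ## §2 (G1) Transport of local intertwiners along a conjugation -/

section Transport

variable {k Γ V W S S' : Type*} [Field k] [Group Γ] [Group S] [Group S'] [AddCommGroup V] [Module k V] [AddCommGroup W] [Module k W]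
  (ρ : Representation k Γ V) (g : Γ) {E E' : Submodule k V}

/-- **(G1) TRANSPORT `Hom_S(E, σ) ≃ₗ Hom_{S′}(E′, σ′)`**: `ρ(g)` maps `E` onto `E′` (`hE`), `S` and `S′` act on `E`, `E′` through `i : S →* Γ`, `i′ : S′ →* Γ` and `ρ` (`hτ`, `hτ′`), `φ : S ≃* S′` is
«conjugation by `g`» (`hφ : i′ (φ s) = g · i s · g⁻¹`), and the targets agree along `φ` (`hσ : σ s = σ′ (φ s)`); then `f ↦ (e′ ↦ f (ρ g⁻¹ e′))` is a linear equivalence.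
[cite: Bump1997, Exercise 4.5.5] [cite: BernsteinZelevinsky1977, §2.3] -/
theorem nonempty_intertwiningMap_linearEquiv_of_transport (hE : E.map (ρ g) = E')
    {i : S →* Γ} {τ : Representation k S E} (hτ : ∀ (s : S) (e : E), ((τ s e : E) : V) = ρ (i s) e)
    {i' : S' →* Γ} {τ' : Representation k S' E'} (hτ' : ∀ (s : S') (e : E'), ((τ' s e : E') : V) = ρ (i' s) e)
    (φ : S ≃* S') (hφ : ∀ s : S, i' (φ s) = g * i s * g⁻¹)
    {σ : Representation k S W} {σ' : Representation k S' W} (hσ : ∀ s : S, σ s = σ' (φ s)) :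
    ∃ eqv : IntertwiningMap τ σ ≃ₗ[k] IntertwiningMap τ' σ', ∀ (f : IntertwiningMap τ σ) (e : E), eqv f ⟨ρ g e, hE ▸ Submodule.mem_map_of_mem e.2⟩ = f e := by
  -- the two mutually inverse linear maps `E′ → E`, `e′ ↦ ρ g⁻¹ e′`, and `E → E′`, `e ↦ ρ g e`
  have hmem' : ∀ e : E, ρ g (e : V) ∈ E' := fun e => hE ▸ Submodule.mem_map_of_mem e.2
  have hmem : ∀ e' : E', ρ g⁻¹ (e' : V) ∈ E := fun e' => by
    have h : (e' : V) ∈ E.map (ρ g) := by rw [hE]; exact e'.2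
    obtain ⟨e, he, hee⟩ := h
    rw [← hee, ← Module.End.mul_apply, ← map_mul, inv_mul_cancel, map_one, Module.End.one_apply]
    exact he
  let T : E' →ₗ[k] E := { toFun := fun e' => ⟨ρ g⁻¹ (e' : V), hmem e'⟩, map_add' := fun x y => Subtype.ext (by simp), map_smul' := fun a x => Subtype.ext (by simp) }
  let T' : E →ₗ[k] E' := { toFun := fun e => ⟨ρ g (e : V), hmem' e⟩, map_add' := fun x y => Subtype.ext (by simp), map_smul' := fun a x => Subtype.ext (by simp) }
  have hTT' : ∀ e : E, T (T' e) = e := fun e => Subtype.ext (by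
    change ρ g⁻¹ (ρ g (e : V)) = e
    rw [← Module.End.mul_apply, ← map_mul, inv_mul_cancel, map_one, Module.End.one_apply])
  have hT'T : ∀ e' : E', T' (T e') = e' := fun e' => Subtype.ext (by
    change ρ g (ρ g⁻¹ (e' : V)) = e'
    rw [← Module.End.mul_apply, ← map_mul, mul_inv_cancel, map_one, Module.End.one_apply])
  -- `T` intertwines `τ′ s′` with `τ (φ⁻¹ s′)`: `ρ g⁻¹ ρ(i′ s′) = ρ(i (φ⁻¹ s′)) ρ g⁻¹`
  have hTτ : ∀ (s : S) (e' : E'), T (τ' (φ s) e') = τ s (T e') := fun s e' => Subtype.ext (by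
    change ρ g⁻¹ ((τ' (φ s) e' : E') : V) = ((τ s (T e') : E) : V)
    rw [hτ', hτ, hφ]
    change ρ g⁻¹ (ρ (g * i s * g⁻¹) (e' : V)) = ρ (i s) (ρ g⁻¹ (e' : V))
    rw [← Module.End.mul_apply, ← map_mul, ← Module.End.mul_apply (ρ (i s)), ← map_mul]
    congr 2
    rw [← mul_assoc, ← mul_assoc, inv_mul_cancel, one_mul])
  have hT'τ : ∀ (s : S) (e : E), T' (τ s e) = τ' (φ s) (T' e) := fun s e => by
    have h := hTτ s (T' e)
    rw [hTT'] at h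
    rw [← h, hT'T]
  refine ⟨{ toFun := fun f => LinearMap.intertwiningMap_of_isIntertwiningMap τ' σ' (f.toLinearMap ∘ₗ T) (fun s' e' => ?_)
            map_add' := fun f f' => IntertwiningMap.ext (LinearMap.ext fun x => rfl)
            map_smul' := fun a f => IntertwiningMap.ext (LinearMap.ext fun x => rfl)
            invFun := fun f' => LinearMap.intertwiningMap_of_isIntertwiningMap τ σ (f'.toLinearMap ∘ₗ T') (fun s e => ?_)
            left_inv := fun f => IntertwiningMap.ext (LinearMap.ext fun e => ?_)
            right_inv := fun f' => IntertwiningMap.ext (LinearMap.ext fun e' => ?_) }, fun f e => ?_⟩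
  · -- equivariance of `f ∘ T`
    obtain ⟨s, rfl⟩ := φ.surjective s'
    rw [LinearMap.comp_apply, LinearMap.comp_apply, hTτ, IntertwiningMap.toLinearMap_apply, IntertwiningMap.isIntertwining τ σ f, hσ]
    rfl
  · -- equivariance of `f′ ∘ T′`
    rw [LinearMap.comp_apply, LinearMap.comp_apply, hT'τ, IntertwiningMap.toLinearMap_apply, IntertwiningMap.isIntertwining τ' σ' f', hσ]
    rfl
  · change f (T (T' e)) = f e
    rw [hTT']
  · change f' (T' (T e')) = f' e'
    rw [hT'T]
  · change f (T ⟨ρ g (e : V), _⟩) = f e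
    congr 1
    exact hTT' e

/-- **`dim Hom_S(E, σ) = dim Hom_{S′}(E′, σ′)`** under (G1)'s hypotheses. [cite: Bump1997, Exercise 4.5.5] [cite: BernsteinZelevinsky1977, §2.3] -/
theorem finrank_intertwiningMap_eq_of_transport (hE : E.map (ρ g) = E')
    {i : S →* Γ} {τ : Representation k S E} (hτ : ∀ (s : S) (e : E), ((τ s e : E) : V) = ρ (i s) e)
    {i' : S' →* Γ} {τ' : Representation k S' E'} (hτ' : ∀ (s : S') (e : E'), ((τ' s e : E') : V) = ρ (i' s) e)
    (φ : S ≃* S') (hφ : ∀ s : S, i' (φ s) = g * i s * g⁻¹)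
    {σ : Representation k S W} {σ' : Representation k S' W} (hσ : ∀ s : S, σ s = σ' (φ s)) :
    Module.finrank k (IntertwiningMap τ σ) = Module.finrank k (IntertwiningMap τ' σ') := by
  obtain ⟨eqv, -⟩ := nonempty_intertwiningMap_linearEquiv_of_transport ρ g hE hτ hτ' φ hφ hσ
  exact eqv.finrank_eq

end Transport

end Representation
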